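import Summits.CriticalPhenomena.PercolationContinuityZ3.Theorems.Transplant.TriClawXTable
import HarnessLib

/-!
# `F □ 𝕋`, p205010-free routing IID: the planar hexagonal claw rule `clawX` SUCCEEDS — clip classes `(3, 4, 1, 3)`, `(3, 4, 1, 4)`, `(3, 4, 2, 2)`, `(3, 4, 2, 3)`, `(3, 4, 2, 4)`, `(3, 4, 3, 3)`, `(3, 4, 3, 4)` (kernel computation)

builds on p205010 (kernel theorem, internal audit signed; external expert review pending) — NOT used in this file.
Lane `prim-bschramm`, seat `prim-bschramm-p2` (gen 51; class C1b, METHOD = input substitution; memo `HOME/bschramm/P2-LATTICES.md` §162); helper file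
(`--supports stmt-CriticalPhenomena-4575 --as helper`).  One `decide +kernel` theorem per clip class `(t_R, t_D, s_R, s_D)` with `t_R = 3` of
«TriClawXTable».`TriClawXOK` (`= ClawXOK`) (standard axioms, default heartbeats, no `native_decide`); the classes with `t_R < 3` (hence `s_R = 3`) follow by the mirror
`(a, b) ↦ (a + b, −b)` in «TriClawXSound».  The four files «TriClawXTableOK{A,B,C,D}» together cover the `28` classes `t_D ∈ {3, 4}`, `s_R ≤ 3`, `s_R ≤ s_D ≤ 4`
(`52 228` admissible configurations; this file: `21420`).
[cite: DuminilCopinSidoraviciusTassion2016, §2.3 (proof of Fact 2: the three disjoint paths in B̄_R(z))]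
-/

namespace Summit.CriticalPhenomena.PercolationContinuityZ3.Theorems.Transplant

namespace TriClawX

/-- Clip class `(t_R, t_D, s_R, s_D) = (3, 4, 1, 3)`. [folklore] -/
theorem triClawXOK_3413 : TriClawXOK 3 4 1 3 := by unfold TriClawXOK ClawXOK; decide +kernel

/-- Clip class `(t_R, t_D, s_R, s_D) = (3, 4, 1, 4)`. [folklore] -/
theorem triClawXOK_3414 : TriClawXOK 3 4 1 4 := by unfold TriClawXOK ClawXOK; decide +kernel

/-- Clip class `(t_R, t_D, s_R, s_D) = (3, 4, 2, 2)`. [folklore] -/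
theorem triClawXOK_3422 : TriClawXOK 3 4 2 2 := by unfold TriClawXOK ClawXOK; decide +kernel

/-- Clip class `(t_R, t_D, s_R, s_D) = (3, 4, 2, 3)`. [folklore] -/
theorem triClawXOK_3423 : TriClawXOK 3 4 2 3 := by unfold TriClawXOK ClawXOK; decide +kernel

/-- Clip class `(t_R, t_D, s_R, s_D) = (3, 4, 2, 4)`. [folklore] -/
theorem triClawXOK_3424 : TriClawXOK 3 4 2 4 := by unfold TriClawXOK ClawXOK; decide +kernel

/-- Clip class `(t_R, t_D, s_R, s_D) = (3, 4, 3, 3)`. [folklore] -/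
theorem triClawXOK_3433 : TriClawXOK 3 4 3 3 := by unfold TriClawXOK ClawXOK; decide +kernel

/-- Clip class `(t_R, t_D, s_R, s_D) = (3, 4, 3, 4)`. [folklore] -/
theorem triClawXOK_3434 : TriClawXOK 3 4 3 4 := by unfold TriClawXOK ClawXOK; decide +kernel

end TriClawX

end Summit.CriticalPhenomena.PercolationContinuityZ3.Theorems.Transplant
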